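import Summits.Parity.BatemanHorn.Theses.AlmostPrimeZeros

/-!
# Crux `LinearCappedRepulsion` (stmt-Parity-11327), line `jensen-stieltjes-majorant`: the composition

Everything here is PROVED.  `LinearCappedRepulsion_of_stubs`: the four stub STATEMENTS of the line
(one-sided tilted majorant of `P_x(z) = Σ_{0≤n≤x} z^{s(n)}` on `‖z − 1‖ ≤ log log x / C`; Rankin
majorant on the real axis; Jensen at the free centre `z = 1` in counting form; Stieltjes/layer-cake
conversion) imply the body of the route decl
`Summit.Parity.BatemanHorn.Theses.AlmostPrimeZeros.LinearCappedRepulsion` (pure bookkeeping; the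
planner's kernel-checked composition of the line skeleton, unchanged).  The stubs themselves are landed
separately (`Theorems/AlmostPrimeZerosLinearCappedRepulsion*.lean`) and assembled in
`Theorems/AlmostPrimeZerosLinearCappedRepulsion.lean`.
-/

namespace Summit.Parity.BatemanHorn.Cruxes.LinearCappedRepulsion.JensenStieltjesMajorant

open scoped BigOperators

/-- **Composition (kernel-checked, no `sorry`): the four stub STATEMENTS imply the crux statement.**
(The conclusion is the body of the route decl verbatim; `LinearCappedRepulsion_of` below instantiates it
with the registered stubs and concludes the route decl BY NAME.)
Bookkeeping: for `x ≥ X := max x₀ (max 3 ⌈exp(exp C)⌉)` one has `L := log log x ≥ C > 0`; apply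
`stub_jensenCount` to `P := P_x` with `Λ := L`, `Λ' := B·L`, `R₁ := L/C ≥ 1` — the disc majorant is
`stub_tiltedMajorant` verbatim (`P_x(1) = x + 1`), the global majorant is `stub_rankinMajorant` at
`y := 1 + ‖z − 1‖ ≥ ‖z‖` through `‖Σ z^{s(n)}‖ ≤ Σ ‖z‖^{s(n)} ≤ Σ y^{s(n)}` — then `stub_stieltjes`
with `K₀ := C + B·C` (`Λ + Λ' = (1 + B)L = K₀·R₁`), `r₀ := e^{−3A}`.  For `x < X` the finitely many
real numbers `T(x)` are bounded by `Σ_{x' < X} |T(x')|`. -/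
theorem LinearCappedRepulsion_of_stubs :
    (∃ A : ℝ, 0 ≤ A ∧ ∃ C : ℝ, 0 < C ∧ ∃ x₀ : ℕ, ∀ x : ℕ, x₀ ≤ x → ∀ z : ℂ,
      ‖z - 1‖ ≤ Real.log (Real.log x) / C →
      ‖∑ n ∈ Finset.range (x + 1), z ^ (n.factorization.sum fun _ v => min v 2)‖ ≤
        ((x : ℝ) + 1) * Real.exp (Real.log (Real.log x) * (z.re - 1) + A * (1 + ‖z - 1‖) ^ (3 / 2 : ℝ))) →
    (∃ B : ℝ, 0 ≤ B ∧ ∀ x : ℕ, 3 ≤ x → ∀ y : ℝ, 1 ≤ y →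
      ∑ n ∈ Finset.range (x + 1), y ^ (n.factorization.sum fun _ v => min v 2) ≤
        ((x : ℝ) + 1) * Real.exp (B * y * Real.log (Real.log x) + B * y ^ (3 / 2 : ℝ))) →
    (∀ (P : Polynomial ℂ) (Λ Λ' R₁ A B : ℝ), P.eval 1 ≠ 0 → 0 ≤ Λ → 0 ≤ Λ' → 1 ≤ R₁ → 0 ≤ A → 0 ≤ B →
      (∀ z : ℂ, ‖z - 1‖ ≤ R₁ →
        ‖P.eval z‖ ≤ ‖P.eval 1‖ * Real.exp (Λ * (z.re - 1) + A * (1 + ‖z - 1‖) ^ (3 / 2 : ℝ))) →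
      (∀ z : ℂ, ‖P.eval z‖ ≤ ‖P.eval 1‖ * Real.exp (Λ' * (1 + ‖z - 1‖) + B * (1 + ‖z - 1‖) ^ (3 / 2 : ℝ))) →
      (∀ ρ ∈ P.roots, Real.exp (-(3 * A)) ≤ ‖(1 : ℂ) - ρ‖) ∧
      (∀ t : ℝ, 0 < t → Real.exp 1 * t ≤ R₁ →
        ((P.roots.filter fun ρ : ℂ => ‖(1 : ℂ) - ρ‖ ≤ t).card : ℝ) ≤ A * (1 + Real.exp 1 * t) ^ (3 / 2 : ℝ)) ∧
      (∀ t : ℝ, 0 < t →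
        ((P.roots.filter fun ρ : ℂ => ‖(1 : ℂ) - ρ‖ ≤ t).card : ℝ) ≤
          (Λ + Λ') * (1 + Real.exp 1 * t) + B * (1 + Real.exp 1 * t) ^ (3 / 2 : ℝ))) →
    (∀ (A B K₀ r₀ : ℝ), 0 ≤ A → 0 ≤ B → 0 ≤ K₀ → 0 < r₀ → ∃ K : ℝ, ∀ (S : Multiset ℂ) (M R₁ : ℝ),
      0 ≤ M → 1 ≤ R₁ → M ≤ K₀ * R₁ →
      (∀ ρ ∈ S, r₀ ≤ ‖(1 : ℂ) - ρ‖) →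
      (∀ t : ℝ, 0 < t → Real.exp 1 * t ≤ R₁ →
        ((S.filter fun ρ : ℂ => ‖(1 : ℂ) - ρ‖ ≤ t).card : ℝ) ≤ A * (1 + Real.exp 1 * t) ^ (3 / 2 : ℝ)) →
      (∀ t : ℝ, 0 < t →
        ((S.filter fun ρ : ℂ => ‖(1 : ℂ) - ρ‖ ≤ t).card : ℝ) ≤
          M * (1 + Real.exp 1 * t) + B * (1 + Real.exp 1 * t) ^ (3 / 2 : ℝ)) →
      (S.map fun ρ : ℂ => (‖(1 : ℂ) - ρ‖ ^ 2)⁻¹).sum ≤ K) →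
    ∃ C : ℝ, ∀ x : ℕ, 2 ≤ x → ((∑ n ∈ Finset.range (x + 1), (Polynomial.X : Polynomial ℂ) ^
      (n.factorization.sum fun _ v => min v 2)).roots.map (fun ρ : ℂ => (‖(1 : ℂ) - ρ‖ ^ 2)⁻¹)).sum ≤ C := by
  intro hTilt hRankin hJensen hStieltjes
  obtain ⟨A, hA0, C, hC, x₀, hmaj⟩ := hTilt
  obtain ⟨B, hB0, hrank⟩ := hRankin
  -- constants of the line
  have hK₀ : (0 : ℝ) ≤ C + B * C := add_nonneg hC.le (mul_nonneg hB0 hC.le)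
  have hr₀ : (0 : ℝ) < Real.exp (-(3 * A)) := Real.exp_pos _
  obtain ⟨K, hK⟩ := hStieltjes A B (C + B * C) (Real.exp (-(3 * A))) hA0 hB0 hK₀ hr₀
  -- threshold beyond which the disc `‖z - 1‖ ≤ L/C` has radius ≥ 1
  set X : ℕ := max x₀ (max 3 ⌈Real.exp (Real.exp C)⌉₊) with hXdef
  -- the main estimate, for x ≥ X
  have main : ∀ x : ℕ, X ≤ x →
      ((∑ n ∈ Finset.range (x + 1), (Polynomial.X : Polynomial ℂ) ^
        (n.factorization.sum fun _ v => min v 2)).roots.map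
          (fun ρ : ℂ => (‖(1 : ℂ) - ρ‖ ^ 2)⁻¹)).sum ≤ K := by
    intro x hx
    have hx₀ : x₀ ≤ x := le_trans (le_max_left _ _) hx
    have hx3 : 3 ≤ x := le_trans ((le_max_left _ _).trans (le_max_right _ _)) hx
    have hxceil : ⌈Real.exp (Real.exp C)⌉₊ ≤ x :=
      le_trans ((le_max_right _ _).trans (le_max_right _ _)) hx
    have hxexp : Real.exp (Real.exp C) ≤ (x : ℝ) :=
      (Nat.le_ceil _).trans (by exact_mod_cast hxceil)
    have hxpos : (0 : ℝ) < x := (Real.exp_pos _).trans_le hxexp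
    have hlogx : Real.exp C ≤ Real.log x := (Real.le_log_iff_exp_le hxpos).2 hxexp
    have hlogpos : 0 < Real.log (x : ℝ) := (Real.exp_pos _).trans_le hlogx
    have hCL : C ≤ Real.log (Real.log x) := (Real.le_log_iff_exp_le hlogpos).2 hlogx
    have hLpos : 0 < Real.log (Real.log x) := hC.trans_le hCL
    have hR₁ : 1 ≤ Real.log (Real.log x) / C := by
      rw [le_div_iff₀ hC]; simpa using hCL
    -- the polynomial and its values
    set P : Polynomial ℂ := ∑ n ∈ Finset.range (x + 1), (Polynomial.X : Polynomial ℂ) ^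
        (n.factorization.sum fun _ v => min v 2) with hPdef
    have hevalz : ∀ z : ℂ, P.eval z =
        ∑ n ∈ Finset.range (x + 1), z ^ (n.factorization.sum fun _ v => min v 2) := by
      intro z; simp [hPdef, Polynomial.eval_finsetSum]
    have heval1 : P.eval 1 = ((x + 1 : ℕ) : ℂ) := by
      simp [hPdef, Polynomial.eval_finsetSum]
    have hnorm1 : ‖P.eval 1‖ = (x : ℝ) + 1 := by
      rw [heval1, Complex.norm_natCast]; push_cast; ring
    have hP1 : P.eval 1 ≠ 0 := by
      rw [heval1]; exact Nat.cast_ne_zero.2 (Nat.succ_ne_zero x)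
    -- disc majorant (stub 1, verbatim)
    have hdisc : ∀ z : ℂ, ‖z - 1‖ ≤ Real.log (Real.log x) / C →
        ‖P.eval z‖ ≤ ‖P.eval 1‖ * Real.exp (Real.log (Real.log x) * (z.re - 1) +
          A * (1 + ‖z - 1‖) ^ (3 / 2 : ℝ)) := by
      intro z hz
      rw [hevalz, hnorm1]
      exact hmaj x hx₀ z hz
    -- global majorant (stub 2 + positivity of the coefficients)
    have hglob : ∀ z : ℂ, ‖P.eval z‖ ≤ ‖P.eval 1‖ *
        Real.exp (B * Real.log (Real.log x) * (1 + ‖z - 1‖) + B * (1 + ‖z - 1‖) ^ (3 / 2 : ℝ)) := by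
      intro z
      have hz1 : ‖z‖ ≤ 1 + ‖z - 1‖ := by
        have h := norm_add_le (z - 1) 1
        simp at h
        linarith
      have hy : (1 : ℝ) ≤ 1 + ‖z - 1‖ := by linarith [norm_nonneg (z - 1)]
      rw [hevalz, hnorm1]
      calc ‖∑ n ∈ Finset.range (x + 1), z ^ (n.factorization.sum fun _ v => min v 2)‖
          ≤ ∑ n ∈ Finset.range (x + 1), (1 + ‖z - 1‖) ^ (n.factorization.sum fun _ v => min v 2) := by
            refine (norm_sum_le _ _).trans (Finset.sum_le_sum fun n _ => ?_)
            rw [norm_pow]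
            exact pow_le_pow_left₀ (norm_nonneg _) hz1 _
        _ ≤ ((x : ℝ) + 1) * Real.exp (B * (1 + ‖z - 1‖) * Real.log (Real.log x) +
              B * (1 + ‖z - 1‖) ^ (3 / 2 : ℝ)) := hrank x hx3 _ hy
        _ = ((x : ℝ) + 1) * Real.exp (B * Real.log (Real.log x) * (1 + ‖z - 1‖) +
              B * (1 + ‖z - 1‖) ^ (3 / 2 : ℝ)) := by ring_nf
    -- Jensen at the free centre (stub 3)
    have hΛ' : 0 ≤ B * Real.log (Real.log x) := mul_nonneg hB0 hLpos.le
    obtain ⟨hfree, hnear, hfar⟩ := hJensen P (Real.log (Real.log x)) (B * Real.log (Real.log x))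
      (Real.log (Real.log x) / C) A B hP1 hLpos.le hΛ' hR₁ hA0 hB0 hdisc hglob
    -- Stieltjes conversion (stub 4)
    have hM0 : 0 ≤ Real.log (Real.log x) + B * Real.log (Real.log x) := add_nonneg hLpos.le hΛ'
    have hM : Real.log (Real.log x) + B * Real.log (Real.log x) ≤
        (C + B * C) * (Real.log (Real.log x) / C) := by
      rw [mul_div_assoc', le_div_iff₀ hC]
      apply le_of_eq
      ring
    exact hK P.roots _ _ hM0 hR₁ hM hfree hnear hfar
  -- the finitely many small x
  refine ⟨max K (∑ x ∈ Finset.range X, |((∑ n ∈ Finset.range (x + 1), (Polynomial.X : Polynomial ℂ) ^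
        (n.factorization.sum fun _ v => min v 2)).roots.map
          (fun ρ : ℂ => (‖(1 : ℂ) - ρ‖ ^ 2)⁻¹)).sum|), fun x _ => ?_⟩
  by_cases hxX : X ≤ x
  · exact (main x hxX).trans (le_max_left _ _)
  · push Not at hxX
    refine le_trans ?_ (le_max_right _ _)
    exact (le_abs_self _).trans
      (Finset.single_le_sum (f := fun x => |((∑ n ∈ Finset.range (x + 1), (Polynomial.X : Polynomial ℂ) ^
        (n.factorization.sum fun _ v => min v 2)).roots.map
          (fun ρ : ℂ => (‖(1 : ℂ) - ρ‖ ^ 2)⁻¹)).sum|)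
        (fun i _ => abs_nonneg _) (Finset.mem_range.2 hxX))



end Summit.Parity.BatemanHorn.Cruxes.LinearCappedRepulsion.JensenStieltjesMajorant
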